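import Summits.Ventures.Crystal3D.Theorems.StickyWulffConstantCoaxialWallLawVicinalReachCore
import Summits.Ventures.Crystal3D.Theorems.StickyWulffConstantCoaxialWallLawVicinalCoherentFault
import Summits.Ventures.Crystal3D.Theorems.StickyWulffConstantCoaxialWallLawInPlaneStackWalkersTwin
import Summits.Ventures.Crystal3D.Theorems.StickyWulffConstantCoaxialWallLawChainTorsionLedger
import HarnessLib

/-!
# The coherent-fault debt is VICINAL: `(√3/2)·sin∠(fault plane, wall) < 9/20` (crux `CoaxialWallLaw`, stmt-Ventures-19481,
# line `WallLedgerF`)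

HONEST FRAMING. Venture `Summits/Ventures/Crystal3D` (cell `crystal3d-full`), helper `--supports` the crux `CoaxialWallLaw`
of `route-Ventures-StickyWulffConstant` (REGISTERED line `WallLedgerF`, open stub `stub_coaxialTwoSlabAdhesion`).  Pure lattice
geometry about the typed debts of `…VicinalSplit` / `…VicinalReachCore`; rung credit; F-C1 not moved; NOT the crux; no census.

Debt D1 (coherent twins) is vicinal by definition of the core (`(√3/2) sin θ_ν < 9/20`).  This file proves the SAME bound for debt
D2 (coherent faults): if a pair of the vicinal core has equal linear lattices and offset `t₂ − t₁ ∈ A₁·(Λ₀ + ℤ√(2/3)n)`,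
`t₂ − t₁ ∉ A₁·Λ₀`, then `(√3/2)·√(1 − ⟪n, e₃⟫²) < 9/20` — the fault plane is within `≈ 31.3°` of the wall.  Otherwise the
steepest in-plane slot `w` of the fault plane is wide (`exists_inPlane_slot_ge_sin`) and dominates `n`; writing `w = uᵢ − uⱼ` with
the rising slots of `n` (`inPlane_slot_eq_sub`), hypothesis (iii) registers the offset for `w` and the plane `n′ = 2√(2/3)A₁uᵢ − n`
through it, while the third rising slot `u_k` is the zone axis of the two planes through `w` and sees the fault vector at `4a/3`:
`level_third_not_mem_two_cosets` — contradiction.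

* `affine_image_eq_of_offset_mem` — equal linear lattices and a lattice offset give equal affine lattices;
* `inPlane_slot_eq_sub` — an in-plane slot of `n` is a difference of two rising slots of `n`, the third one orthogonal to it;
* **`coherentFault_vicinal`** — the bound; **`coherentFaultPair_vicinal_of_vicinalPair`** — packaged for `CoherentFaultPair`.
READING: both coherent debts of lane F live in the cone `sin θ < 0.52` about the twin / fault plane (numerics: D2 survivors for
47 % of Haar wall normals = the cones `θ* ≲ 29°–31°` about the eight `{111}` axes).
WHAT THIS IS NOT: not the stub; F-C1 not moved.
-/

noncomputable section

namespace Summit.Ventures.Crystal3D.Theorems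

open Summit.Ventures.Crystal3D Finset
open Literature.MathematicalPhysics.StatisticalMechanics (fccStacking barlowStacking IsHaggSeq contactDeficiency)
open scoped InnerProductSpace

/-- Equal linear lattices and a lattice offset give equal affine lattices. -/
theorem affine_image_eq_of_offset_mem {A₁ A₂ : EuclideanSpace ℝ (Fin 3) ≃ₗᵢ[ℝ] EuclideanSpace ℝ (Fin 3)}
    {t₁ t₂ : EuclideanSpace ℝ (Fin 3)}
    (hΛ : A₂ '' fccStacking 1 (Real.sqrt (2 / 3)) = A₁ '' fccStacking 1 (Real.sqrt (2 / 3)))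
    (hτ : A₁.symm (t₂ - t₁) ∈ fccStacking 1 (Real.sqrt (2 / 3))) :
    (fun p => A₁ p + t₁) '' fccStacking 1 (Real.sqrt (2 / 3)) = (fun p => A₂ p + t₂) '' fccStacking 1 (Real.sqrt (2 / 3)) := by
  have hw : t₂ - t₁ = A₁ (A₁.symm (t₂ - t₁)) := (A₁.apply_symm_apply _).symm
  set w := A₁.symm (t₂ - t₁) with hwdef
  ext y
  constructor
  · rintro ⟨x, hx, rfl⟩
    have hmem : A₁ (x - w) ∈ A₂ '' fccStacking 1 (Real.sqrt (2 / 3)) := by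
      rw [hΛ]; exact ⟨x - w, fcc_sub_site_mem hx hτ, rfl⟩
    obtain ⟨x', hx', hx'e⟩ := hmem
    refine ⟨x', hx', ?_⟩
    simp only
    rw [hx'e, map_sub, ← hw]; abel
  · rintro ⟨x', hx', rfl⟩
    have hmem : A₂ x' ∈ A₁ '' fccStacking 1 (Real.sqrt (2 / 3)) := by rw [← hΛ]; exact ⟨x', hx', rfl⟩
    obtain ⟨x, hx, hxe⟩ := hmem
    refine ⟨x + w, fcc_add_site_mem hx hτ, ?_⟩
    simp only
    rw [map_add, ← hw, hxe]; abel

/-- **An in-plane slot of `n` is a difference of two rising slots of `n`, and the third rising slot is orthogonal to it.** -/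
theorem inPlane_slot_eq_sub (A : EuclideanSpace ℝ (Fin 3) ≃ₗᵢ[ℝ] EuclideanSpace ℝ (Fin 3)) {n w : EuclideanSpace ℝ (Fin 3)}
    (hn : ‖n‖ = 1)
    (hmenu : ∀ v ∈ fccSlots, ⟪A v, n⟫_ℝ = 0 ∨ ⟪A v, n⟫_ℝ = Real.sqrt (2 / 3) ∨ ⟪A v, n⟫_ℝ = -Real.sqrt (2 / 3))
    (hw : w ∈ fccSlots) (hwn : ⟪A w, n⟫_ℝ = 0) :
    ∃ uᵢ ∈ fccSlots, ∃ uⱼ ∈ fccSlots, ∃ uₖ ∈ fccSlots,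
      ⟪A uᵢ, n⟫_ℝ = Real.sqrt (2 / 3) ∧ ⟪A uⱼ, n⟫_ℝ = Real.sqrt (2 / 3) ∧ ⟪A uₖ, n⟫_ℝ = Real.sqrt (2 / 3) ∧
      ⟪uᵢ, uⱼ⟫_ℝ = 1 / 2 ∧ ⟪uᵢ, uₖ⟫_ℝ = 1 / 2 ∧ ⟪uⱼ, uₖ⟫_ℝ = 1 / 2 ∧
      ⟪w, uᵢ⟫_ℝ = 1 / 2 ∧ ⟪w, uⱼ⟫_ℝ = -(1 / 2) ∧ ⟪w, uₖ⟫_ℝ = 0 := by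
  obtain ⟨u₁, hu₁, u₂, hu₂, u₃, hu₃, hn₁, hn₂, hn₃, h12, h13, h23, -, -⟩ := exists_far_frame A hn hmenu
  have nw := norm_eq_one_of_mem_fccSlots hw
  have nu : ∀ u ∈ fccSlots, ‖A u‖ = 1 := fun u hu => by rw [LinearIsometryEquiv.norm_map, norm_eq_one_of_mem_fccSlots hu]
  -- the far frame moved by `A`, tested against `z = A w`
  have hsq := sum_sq_inner_cappers (nu u₁ hu₁) (nu u₂ hu₂) (nu u₃ hu₃) hn (by rw [LinearIsometryEquiv.norm_map, nw])
    (by rw [A.inner_map_map]; exact h12) (by rw [A.inner_map_map]; exact h13) (by rw [A.inner_map_map]; exact h23) hn₁ hn₂ hn₃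
    (z := A w)
  have hsumv := sum_eq_sqrt_six_smul (A u₁) (A u₂) (A u₃) n (nu u₁ hu₁) (nu u₂ hu₂) (nu u₃ hu₃) hn
    (by rw [A.inner_map_map]; exact h12) (by rw [A.inner_map_map]; exact h13) (by rw [A.inner_map_map]; exact h23) hn₁ hn₂ hn₃
  have hsum : ⟪A u₁, A w⟫_ℝ + ⟪A u₂, A w⟫_ℝ + ⟪A u₃, A w⟫_ℝ = 0 := by
    have := congrArg (fun v => ⟪v, A w⟫_ℝ) hsumv
    simp only [inner_add_left, real_inner_smul_left] at this
    rw [this, real_inner_comm, hwn, mul_zero]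
  rw [real_inner_comm (A w) n, hwn] at hsq
  simp only [A.inner_map_map] at hsq hsum
  norm_num at hsq
  -- each `⟪uₗ, w⟫ ∈ {½, 0, −½}` (the values `±1` are excluded by the second moment); sum `0`, sum of squares `½`
  have hwi : ∀ u, ⟪w, u⟫_ℝ = ⟪u, w⟫_ℝ := fun u => real_inner_comm _ _
  have h21 : ⟪u₂, u₁⟫_ℝ = 1 / 2 := by rw [real_inner_comm]; exact h12
  have h31 : ⟪u₃, u₁⟫_ℝ = 1 / 2 := by rw [real_inner_comm]; exact h13
  have h32 : ⟪u₃, u₂⟫_ℝ = 1 / 2 := by rw [real_inner_comm]; exact h23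
  have tri : ∀ u ∈ fccSlots, ⟪u, w⟫_ℝ ^ 2 ≤ 1 / 2 → ⟪u, w⟫_ℝ = 1 / 2 ∨ ⟪u, w⟫_ℝ = 0 ∨ ⟪u, w⟫_ℝ = -(1 / 2) := by
    intro u hu hsq'
    rcases inner_slots_mem hu hw with h | h | h | h | h
    · exfalso; rw [h] at hsq'; norm_num at hsq'
    · exact Or.inl h
    · exact Or.inr (Or.inl h)
    · exact Or.inr (Or.inr h)
    · exfalso; rw [h] at hsq'; norm_num at hsq'
  have ha := tri u₁ hu₁ (by nlinarith [hsq, sq_nonneg ⟪u₂, w⟫_ℝ, sq_nonneg ⟪u₃, w⟫_ℝ])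
  have hb := tri u₂ hu₂ (by nlinarith [hsq, sq_nonneg ⟪u₁, w⟫_ℝ, sq_nonneg ⟪u₃, w⟫_ℝ])
  have hc := tri u₃ hu₃ (by nlinarith [hsq, sq_nonneg ⟪u₁, w⟫_ℝ, sq_nonneg ⟪u₂, w⟫_ℝ])
  rcases ha with ha | ha | ha <;> rcases hb with hb | hb | hb <;> rcases hc with hc | hc | hc
  · exfalso; have key := And.intro hsum hsq; norm_num [ha, hb, hc] at key
  · exfalso; have key := And.intro hsum hsq; norm_num [ha, hb, hc] at key
  · exfalso; have key := And.intro hsum hsq; norm_num [ha, hb, hc] at key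
  · exfalso; have key := And.intro hsum hsq; norm_num [ha, hb, hc] at key
  · exfalso; have key := And.intro hsum hsq; norm_num [ha, hb, hc] at key
  · exact ⟨u₁, hu₁, u₃, hu₃, u₂, hu₂, hn₁, hn₃, hn₂, h13, h12, h32,
      by rw [hwi, ha], by rw [hwi, hc], by rw [hwi, hb]⟩
  · exfalso; have key := And.intro hsum hsq; norm_num [ha, hb, hc] at key
  · exact ⟨u₁, hu₁, u₂, hu₂, u₃, hu₃, hn₁, hn₂, hn₃, h12, h13, h23,
      by rw [hwi, ha], by rw [hwi, hb], by rw [hwi, hc]⟩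
  · exfalso; have key := And.intro hsum hsq; norm_num [ha, hb, hc] at key
  · exfalso; have key := And.intro hsum hsq; norm_num [ha, hb, hc] at key
  · exfalso; have key := And.intro hsum hsq; norm_num [ha, hb, hc] at key
  · exact ⟨u₂, hu₂, u₃, hu₃, u₁, hu₁, hn₂, hn₃, hn₁, h23, h21, h31,
      by rw [hwi, hb], by rw [hwi, hc], by rw [hwi, ha]⟩
  · exfalso; have key := And.intro hsum hsq; norm_num [ha, hb, hc] at key
  · exfalso; have key := And.intro hsum hsq; norm_num [ha, hb, hc] at key
  · exfalso; have key := And.intro hsum hsq; norm_num [ha, hb, hc] at key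
  · exact ⟨u₃, hu₃, u₂, hu₂, u₁, hu₁, hn₃, hn₂, hn₁, h32, h31, h21,
      by rw [hwi, hc], by rw [hwi, hb], by rw [hwi, ha]⟩
  · exfalso; have key := And.intro hsum hsq; norm_num [ha, hb, hc] at key
  · exfalso; have key := And.intro hsum hsq; norm_num [ha, hb, hc] at key
  · exfalso; have key := And.intro hsum hsq; norm_num [ha, hb, hc] at key
  · exact ⟨u₂, hu₂, u₁, hu₁, u₃, hu₃, hn₂, hn₁, hn₃, h21, h23, h13,
      by rw [hwi, hb], by rw [hwi, ha], by rw [hwi, hc]⟩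
  · exfalso; have key := And.intro hsum hsq; norm_num [ha, hb, hc] at key
  · exact ⟨u₃, hu₃, u₁, hu₁, u₂, hu₂, hn₃, hn₁, hn₂, h31, h32, h12,
      by rw [hwi, hc], by rw [hwi, ha], by rw [hwi, hb]⟩
  · exfalso; have key := And.intro hsum hsq; norm_num [ha, hb, hc] at key
  · exfalso; have key := And.intro hsum hsq; norm_num [ha, hb, hc] at key
  · exfalso; have key := And.intro hsum hsq; norm_num [ha, hb, hc] at key
  · exfalso; have key := And.intro hsum hsq; norm_num [ha, hb, hc] at key
  · exfalso; have key := And.intro hsum hsq; norm_num [ha, hb, hc] at key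

/-- **The coherent-fault debt is vicinal.**  In the vicinal core, a translation pair whose offset lies in the fault coset
`A₁·(Λ₀ + ℤ√(2/3)n)` of a unit menu normal `n` but not in `A₁·Λ₀` has `(√3/2)·√(1 − ⟪n, e₃⟫²) < 9/20`. -/
theorem coherentFault_vicinal
    (A₁ : EuclideanSpace ℝ (Fin 3) ≃ₗᵢ[ℝ] EuclideanSpace ℝ (Fin 3)) (t₁ : EuclideanSpace ℝ (Fin 3))
    (A₂ : EuclideanSpace ℝ (Fin 3) ≃ₗᵢ[ℝ] EuclideanSpace ℝ (Fin 3)) (t₂ : EuclideanSpace ℝ (Fin 3))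
    (hV : VicinalPair A₁ t₁ A₂ t₂)
    (hne : (fun p => A₁ p + t₁) '' fccStacking 1 (Real.sqrt (2 / 3)) ≠ (fun p => A₂ p + t₂) '' fccStacking 1 (Real.sqrt (2 / 3)))
    (hΛ : A₂ '' fccStacking 1 (Real.sqrt (2 / 3)) = A₁ '' fccStacking 1 (Real.sqrt (2 / 3)))
    {n : EuclideanSpace ℝ (Fin 3)} (hn : ‖n‖ = 1)
    (hmenu : ∀ w ∈ fccSlots, ⟪A₁ w, n⟫_ℝ = 0 ∨ ⟪A₁ w, n⟫_ℝ = Real.sqrt (2 / 3) ∨ ⟪A₁ w, n⟫_ℝ = -Real.sqrt (2 / 3))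
    {a : ℤ} (ha : A₁.symm (t₂ - t₁ - (a : ℝ) • (Real.sqrt (2 / 3) • n)) ∈ fccStacking 1 (Real.sqrt (2 / 3))) :
    Real.sqrt 3 / 2 * Real.sqrt (1 - ⟪n, EuclideanSpace.single (2 : Fin 3) (1 : ℝ)⟫_ℝ ^ 2) < 9 / 20 := by
  set e : EuclideanSpace ℝ (Fin 3) := EuclideanSpace.single (2 : Fin 3) (1 : ℝ) with he
  by_contra hge
  push Not at hge
  obtain ⟨_, _, hreg⟩ := hV
  have h23 : Real.sqrt (2 / 3) * Real.sqrt (2 / 3) = 2 / 3 := Real.mul_self_sqrt (by norm_num)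
  have h62 : Real.sqrt 6 * Real.sqrt (2 / 3) = 2 := by
    rw [← Real.sqrt_mul (by norm_num), show (6 : ℝ) * (2 / 3) = 2 ^ 2 by norm_num, Real.sqrt_sq (by norm_num)]
  -- the steepest in-plane slot `w` of the fault plane: wide and dominating `n`
  have hlt : ⟪n, e⟫_ℝ ^ 2 < 1 := by
    by_contra hge'
    push Not at hge'
    have : Real.sqrt (1 - ⟪n, e⟫_ℝ ^ 2) = 0 := Real.sqrt_eq_zero'.2 (by linarith)
    rw [this, mul_zero] at hge
    norm_num at hge
  obtain ⟨w, hw, hwn, hwe⟩ := exists_inPlane_slot_ge_sin A₁ hn hmenu hlt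
  have hwide : (9 / 20 : ℝ) ≤ ⟪A₁ w, e⟫_ℝ := hge.trans hwe
  have hdom : Real.sqrt (1 - ⟪n, e⟫_ℝ ^ 2) ≤ Real.sqrt 2 * ⟪A₁ w, e⟫_ℝ := by
    have hs0 : 0 ≤ Real.sqrt (1 - ⟪n, e⟫_ℝ ^ 2) := Real.sqrt_nonneg _
    have h3 : Real.sqrt 3 / 2 ≤ Real.sqrt 2 := by
      have a : Real.sqrt 3 ≤ 2 := by
        rw [show (2 : ℝ) = Real.sqrt (2 ^ 2) by rw [Real.sqrt_sq (by norm_num)]]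
        exact Real.sqrt_le_sqrt (by norm_num)
      have b : (1 : ℝ) ≤ Real.sqrt 2 := by
        rw [show (1 : ℝ) = Real.sqrt 1 by rw [Real.sqrt_one]]
        exact Real.sqrt_le_sqrt (by norm_num)
      linarith
    have hw0 : 0 ≤ ⟪A₁ w, e⟫_ℝ := by linarith
    calc Real.sqrt (1 - ⟪n, e⟫_ℝ ^ 2) = 1 * Real.sqrt (1 - ⟪n, e⟫_ℝ ^ 2) := (one_mul _).symm
      _ ≤ (2 / Real.sqrt 3) * (Real.sqrt 3 / 2 * Real.sqrt (1 - ⟪n, e⟫_ℝ ^ 2)) := by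
          have h3pos : 0 < Real.sqrt 3 := Real.sqrt_pos.2 (by norm_num)
          rw [← mul_assoc, show 2 / Real.sqrt 3 * (Real.sqrt 3 / 2) = 1 by field_simp]
      _ ≤ (2 / Real.sqrt 3) * ⟪A₁ w, e⟫_ℝ := mul_le_mul_of_nonneg_left hwe (by positivity)
      _ ≤ Real.sqrt 2 * ⟪A₁ w, e⟫_ℝ := by
          apply mul_le_mul_of_nonneg_right _ hw0
          -- `2/√3 ≤ √2`
          have h3pos : 0 < Real.sqrt 3 := Real.sqrt_pos.2 (by norm_num)
          rw [div_le_iff₀ h3pos, ← Real.sqrt_mul (by norm_num), show (2 : ℝ) = Real.sqrt (2 ^ 2) by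
            rw [Real.sqrt_sq (by norm_num)]]
          exact Real.sqrt_le_sqrt (by norm_num)
  -- `w = uᵢ − uⱼ`, zone axis `uₖ`
  obtain ⟨uᵢ, huᵢ, uⱼ, huⱼ, uₖ, huₖ, hnᵢ, hnⱼ, hnₖ, hij, hik, hjk, hwi, hwj, hwk⟩ := inPlane_slot_eq_sub A₁ hn hmenu hw hwn
  -- the second plane through `w`: `n' = 2√(2/3)A₁uᵢ − n`
  set n' : EuclideanSpace ℝ (Fin 3) := (2 * Real.sqrt (2 / 3)) • A₁ uᵢ - n with hn'
  have hn'1 : ‖n'‖ = 1 := norm_mirror_normal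
    (by rw [LinearIsometryEquiv.norm_map, norm_eq_one_of_mem_fccSlots huᵢ]) hn hnᵢ
  have hn'menu := menu_mirror_slot A₁ hmenu huᵢ hnᵢ
  have hwn' : ⟪A₁ w, n'⟫_ℝ = Real.sqrt (2 / 3) := by
    rw [hn', inner_sub_right, real_inner_smul_right, A₁.inner_map_map, hwi, hwn]; ring
  have hzone : ⟪A₁ uₖ, n'⟫_ℝ = 0 := by
    rw [hn', inner_sub_right, real_inner_smul_right, A₁.inner_map_map, real_inner_comm, hik, hnₖ]; ring
  have hperp : ⟪uₖ, w⟫_ℝ = 0 := by rw [real_inner_comm]; exact hwk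
  -- the registration for `(w, n')` from hypothesis (iii)
  obtain ⟨y₆, hy₆, hAy₆⟩ := exists_lattice_eq_sqrt6_menu A₁ hmenu
  set lam := A₁.symm (t₂ - t₁ - (a : ℝ) • (Real.sqrt (2 / 3) • n)) with hlam
  -- `3(t₂ − t₁) = A₁(3·lam + a·y₆)`
  set y : EuclideanSpace ℝ (Fin 3) := (3 : ℝ) • lam + (a : ℝ) • y₆ with hydef
  have hy : y ∈ fccStacking 1 (Real.sqrt (2 / 3)) := by
    have h3 := fcc_zsmul_mem 3 ha
    have h4 := fcc_zsmul_mem a hy₆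
    push_cast at h3
    exact fcc_add_site_mem h3 h4
  have hAlam : A₁ lam = t₂ - t₁ - (a : ℝ) • (Real.sqrt (2 / 3) • n) := by
    rw [hlam, LinearIsometryEquiv.apply_symm_apply]
  have ht : t₂ - t₁ = A₁ ((3 : ℝ)⁻¹ • y) := by
    symm
    rw [hydef, map_smul, map_add, map_smul, map_smul, hAy₆, hAlam, ← three_mul_sqrt_twoThirds]
    module
  have h3 : A₁.symm ((3 : ℝ) • (t₂ - t₁)) ∈ fccStacking 1 (Real.sqrt (2 / 3)) := by
    rw [ht, map_smul, LinearIsometryEquiv.symm_apply_apply, smul_smul, mul_inv_cancel₀ (by norm_num : (3 : ℝ) ≠ 0), one_smul]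
    exact hy
  have hR := hreg h3 n hn hmenu (Or.inl hΛ) w hw hwide hdom n' hn'1 hn'menu hwn' (Or.inl hΛ)
  -- `2⟪y, uₖ⟫ = 3·(2⟪lam, uₖ⟫) + 4a`, not divisible by 3 since `3 ∤ a`
  obtain ⟨j, hj⟩ := exists_int_two_inner_slot ha huₖ
  have hykey : 2 * ⟪y, uₖ⟫_ℝ = ((3 * j + 4 * a : ℤ) : ℝ) := by
    rw [hydef, inner_add_left, real_inner_smul_left, real_inner_smul_left]
    have : ⟪y₆, uₖ⟫_ℝ = 2 := by
      rw [← A₁.inner_map_map, hAy₆, real_inner_smul_left, real_inner_comm, hnₖ, h62]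
    rw [this]; push_cast; linarith [hj]
  have h3a : ¬ (3 : ℤ) ∣ a := by
    rintro ⟨q, hq⟩
    apply hne
    apply affine_image_eq_of_offset_mem hΛ
    -- `t₂ − t₁ = A₁ lam + a√(2/3) n = A₁ (lam + q·y₆)`
    have : A₁.symm (t₂ - t₁) = lam + (q : ℝ) • y₆ := by
      apply A₁.injective
      rw [LinearIsometryEquiv.apply_symm_apply, map_add, map_smul, hAy₆, hlam, LinearIsometryEquiv.apply_symm_apply]
      have hq' : (a : ℝ) = 3 * (q : ℝ) := by exact_mod_cast hq
      rw [hq', smul_smul, show (q : ℝ) • (Real.sqrt 6 • n) = (3 * (q : ℝ) * Real.sqrt (2 / 3)) • n by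
        rw [smul_smul, ← three_mul_sqrt_twoThirds]; ring_nf]
      abel
    rw [this]
    exact fcc_add_site_mem ha (fcc_zsmul_mem q hy₆)
  have h3m : ¬ (3 : ℤ) ∣ (3 * j + 4 * a) := by
    rintro ⟨q, hq⟩; exact h3a ⟨q - j - a, by linarith⟩
  obtain ⟨-, hnot⟩ := level_third_not_mem_two_cosets A₁ hy ht huₖ hperp hzone hykey h3m
  obtain ⟨a', b', hab⟩ := hR
  exact hnot a' b' hab

/-- **Packaged**: a `CoherentFaultPair` of the vicinal core has its fault plane vicinal. -/
theorem coherentFaultPair_vicinal_of_vicinalPair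
    (A₁ : EuclideanSpace ℝ (Fin 3) ≃ₗᵢ[ℝ] EuclideanSpace ℝ (Fin 3)) (t₁ : EuclideanSpace ℝ (Fin 3))
    (A₂ : EuclideanSpace ℝ (Fin 3) ≃ₗᵢ[ℝ] EuclideanSpace ℝ (Fin 3)) (t₂ : EuclideanSpace ℝ (Fin 3))
    (hV : VicinalPair A₁ t₁ A₂ t₂)
    (hne : (fun p => A₁ p + t₁) '' fccStacking 1 (Real.sqrt (2 / 3)) ≠ (fun p => A₂ p + t₂) '' fccStacking 1 (Real.sqrt (2 / 3)))
    (hF : CoherentFaultPair A₁ t₁ A₂ t₂) :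
    ∃ n : EuclideanSpace ℝ (Fin 3), ‖n‖ = 1 ∧
      (∀ w ∈ fccSlots, ⟪A₁ w, n⟫_ℝ = 0 ∨ ⟪A₁ w, n⟫_ℝ = Real.sqrt (2 / 3) ∨ ⟪A₁ w, n⟫_ℝ = -Real.sqrt (2 / 3)) ∧
      (∃ a : ℤ, A₁.symm (t₂ - t₁ - (a : ℝ) • (Real.sqrt (2 / 3) • n)) ∈ fccStacking 1 (Real.sqrt (2 / 3))) ∧
      Real.sqrt 3 / 2 * Real.sqrt (1 - ⟪n, EuclideanSpace.single (2 : Fin 3) (1 : ℝ)⟫_ℝ ^ 2) < 9 / 20 := by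
  obtain ⟨hΛ, n, hn, hmenu, a, ha⟩ := hF
  exact ⟨n, hn, hmenu, ⟨a, ha⟩, coherentFault_vicinal A₁ t₁ A₂ t₂ hV hne hΛ hn hmenu ha⟩

/-- **The fault debts may assume a VICINAL fault plane.**  The coherent-fault debt of the split (`…VicinalSplit`) follows
from its restriction to pairs whose fault normal `n` satisfies `(√3/2)·√(1 − ⟪n,e₃⟫²) < 9/20` — so the census translation rows
need only vicinal basal-fault staircases. -/
theorem coaxialTwoSlabAdhesionCoherentFault_of_vicinalFault
    (h : CoaxialTwoSlabAdhesionOn fun A₁ t₁ A₂ t₂ =>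
      (VicinalPair A₁ t₁ A₂ t₂ ∧ ¬ CoherentTwinPair A₁ t₁ A₂ t₂) ∧
      A₂ '' fccStacking 1 (Real.sqrt (2 / 3)) = A₁ '' fccStacking 1 (Real.sqrt (2 / 3)) ∧
      ∃ n : EuclideanSpace ℝ (Fin 3), ‖n‖ = 1 ∧
        (∀ w ∈ fccSlots, ⟪A₁ w, n⟫_ℝ = 0 ∨ ⟪A₁ w, n⟫_ℝ = Real.sqrt (2 / 3) ∨ ⟪A₁ w, n⟫_ℝ = -Real.sqrt (2 / 3)) ∧
        (∃ a : ℤ, A₁.symm (t₂ - t₁ - (a : ℝ) • (Real.sqrt (2 / 3) • n)) ∈ fccStacking 1 (Real.sqrt (2 / 3))) ∧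
        Real.sqrt 3 / 2 * Real.sqrt (1 - ⟪n, EuclideanSpace.single (2 : Fin 3) (1 : ℝ)⟫_ℝ ^ 2) < 9 / 20) :
    CoaxialTwoSlabAdhesionCoherentFault := by
  intro A₁ t₁ A₂ t₂ hco hne hS
  obtain ⟨⟨hV, hT⟩, hF⟩ := hS
  exact h A₁ t₁ A₂ t₂ hco hne ⟨⟨hV, hT⟩, hF.1, coherentFaultPair_vicinal_of_vicinalPair A₁ t₁ A₂ t₂ hV hne hF⟩

/-- The same for the REACH fault debt (`…VicinalReachCore`). -/
theorem coaxialTwoSlabAdhesionReachCoherentFault_of_vicinalFault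
    (h : CoaxialTwoSlabAdhesionOn fun A₁ t₁ A₂ t₂ =>
      (ReachPair A₁ t₁ A₂ t₂ ∧ ¬ CoherentTwinPair A₁ t₁ A₂ t₂) ∧
      A₂ '' fccStacking 1 (Real.sqrt (2 / 3)) = A₁ '' fccStacking 1 (Real.sqrt (2 / 3)) ∧
      ∃ n : EuclideanSpace ℝ (Fin 3), ‖n‖ = 1 ∧
        (∀ w ∈ fccSlots, ⟪A₁ w, n⟫_ℝ = 0 ∨ ⟪A₁ w, n⟫_ℝ = Real.sqrt (2 / 3) ∨ ⟪A₁ w, n⟫_ℝ = -Real.sqrt (2 / 3)) ∧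
        (∃ a : ℤ, A₁.symm (t₂ - t₁ - (a : ℝ) • (Real.sqrt (2 / 3) • n)) ∈ fccStacking 1 (Real.sqrt (2 / 3))) ∧
        Real.sqrt 3 / 2 * Real.sqrt (1 - ⟪n, EuclideanSpace.single (2 : Fin 3) (1 : ℝ)⟫_ℝ ^ 2) < 9 / 20) :
    CoaxialTwoSlabAdhesionReachCoherentFault := by
  intro A₁ t₁ A₂ t₂ hco hne hS
  obtain ⟨⟨hR, hT⟩, hF⟩ := hS
  exact h A₁ t₁ A₂ t₂ hco hne ⟨⟨hR, hT⟩, hF.1, coherentFaultPair_vicinal_of_vicinalPair A₁ t₁ A₂ t₂ hR.1 hne hF⟩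

end Summit.Ventures.Crystal3D.Theorems

end
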